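import Literature.AlgebraicGeometry.Motives.AbelianVarietyUnirationalConstant
import Literature.AlgebraicGeometry.Motives.ProjectiveSpaceLinearSubspaceSection
import HarnessLib

/-!
# Rational maps `ℙ¹ ⇢ A` and `𝔸¹ ⇢ A` to an abelian variety are constant
# (Milne, *Abelian Varieties*, §3 Cor. 3.8, as printed)

Topic `Literature/AlgebraicGeometry/Motives`, namespace `Literature.AlgebraicGeometry.Motives`;
THEOREMS ONLY (no definition, no named fact, no instance, sorry-free; D-0026).

Milne, *Abelian Varieties* (in Cornell–Silverman, *Arithmetic Geometry*), §3 Cor. 3.8: "Every rational map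
`f : ℙ¹ → A` is constant."  The tree's named fact ★ `Milne1986_projectiveLine_to_abelianVariety_const` records the
MORPHISM form (`ℙ¹ → A` constant on points) and carries `-- TODO(general form): Milne's statement is for rational
maps ℙ¹ ⇢ A`. This file proves the printed RATIONAL-MAP form, in the section form of
★ `Motives/AbelianVarietyUnirationalConstant`: a rational map is a `K`-morphism from a non-empty open `U`, and

* **`AbelianVariety.exists_eq_comp_of_opens_affineLine`** — every `K`-morphism `g : U → A` from a non-empty open
  `U ⊆ 𝔸¹_K = Spec K[X₀]` is `g = (U → Spec K) ≫ P₀` for a section `P₀ : Spec K → A`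
  (★ `AbelianVariety.exists_eq_hom_comp_of_isDominant` with the dominant identity of `U`);
* **`AbelianVariety.exists_eq_hom_comp_of_isDominant_of_algEquiv`** — transport of
  ★ `AbelianVariety.exists_eq_hom_comp_of_isDominant` to opens of `Spec R` for `R ≃ₐ[K] K[X₀]` (the charts of `ℙ¹`);
* **`AbelianVariety.exists_eq_comp_of_opens_projectiveLine`** — every `K`-morphism `g : U → A` from a non-empty open
  `U ⊆ ℙ¹_K` is `g = (U → Spec K) ≫ P₀`: `U` contains the generic point, which lies in the standard chart
  `D₊(x₀) ≅ 𝔸¹` (★ `ProjectiveSpace.chartCover`, `ProjectiveSpace.chartAlgEquiv`), and `D₊(x₀) ∩ U → U` is a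
  dominant open immersion;
* (ed. 2) **`AbelianVariety.exists_eq_hom_comp_projectiveLine`** — the scheme-theoretic form of the ★ named fact on all of
  `ℙ¹`: every `K`-morphism `f : ℙ¹_K → A` is `f = (ℙ¹ → Spec K) ≫ P₀` (the chart `D₊(x₀) → ℙ¹` is dominant).

With Milne's Thm. 3.1 (★ `AbelianVariety.existsUnique_extension`: a rational map from a non-singular variety to an
abelian variety is a morphism) the rational-map form also follows from the morphism form; the route here is the
birational one of ★ `AbelianVarietyUnirationalConstant`, which does not need smoothness of the source.

Cell `hodgecm-mathlib` (D-0151), count-neutral capital of the (W1) Weil–Jacobian lineage. HC_CM is proved only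
modulo the 7 printed citations until rung 0 closes; this file discharges none of them.

## References

* J. S. Milne, *Abelian Varieties*, in G. Cornell, J. H. Silverman (eds.), *Arithmetic Geometry* (Storrs 1984),
  Springer 1986, Ch. V, §3 Thm. 3.1 and Cor. 3.8 (p. 107). [Milne1986AbelianVarieties]
* R. Hartshorne, *Algebraic Geometry*, GTM 52 (1977), II Prop. 2.5(b) (standard affine cover of `Proj`).
  [Hartshorne1977]
-/

set_option autoImplicit false

noncomputable section

universe u

open CategoryTheory CategoryTheory.Limits AlgebraicGeometry MonoidalCategory CartesianMonoidalCategory MonObj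

namespace Literature.AlgebraicGeometry.Motives

open AbelianVarietyRationalCurves

/-! ### Rational maps `𝔸¹ ⇢ A` and `ℙ¹ ⇢ A` are constant (Milne, *Abelian Varieties*, §3 Cor. 3.8 as printed) -/

section RationalMaps

variable {K : Type u} [Field K]

set_option backward.isDefEq.respectTransparency false in
/-- Transport of `AbelianVariety.exists_eq_hom_comp_of_isDominant` along a `K`-algebra isomorphism `R ≃ₐ[K] K[X₀]`:
a reduced (here: integral) `K`-scheme dominated by a non-empty open of `Spec R` admits only constant `K`-morphisms to
abelian varieties (used for the standard charts of `ℙ¹`). [cite: Milne1986AbelianVarieties, §3 Thm. 3.1 and Cor. 3.8 (p. 107)] -/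
theorem AbelianVariety.exists_eq_hom_comp_of_isDominant_of_algEquiv (C : SchemeOver K) [IsIntegral C.left]
    {R : Type u} [CommRing R] [Algebra K R] (e : R ≃ₐ[K] R₁ K) {U : (Spec (CommRingCat.of R)).Opens}
    [Nonempty (U : Scheme.{u})] (f : (U : Scheme.{u}) ⟶ C.left) [IsDominant f]
    (hfw : f ≫ C.hom = U.ι ≫ Spec.map (CommRingCat.ofHom (algebraMap K R))) (A : AbelianVariety K)
    (ψ : C ⟶ A.X) :
    ∃ P₀ : Spec (.of K) ⟶ A.X.left, P₀ ≫ A.X.hom = 𝟙 _ ∧ ψ.left = C.hom ≫ P₀ := by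
  -- the isomorphism `ι = Spec e : Spec K[X₀] ⟶ Spec R`
  haveI : IsIso (CommRingCat.ofHom (e : R →+* R₁ K)) :=
    ⟨⟨CommRingCat.ofHom (e.symm : R₁ K →+* R),
      by apply CommRingCat.hom_ext; exact RingHom.ext fun x => by simp,
      by apply CommRingCat.hom_ext; exact RingHom.ext fun x => by simp⟩⟩
  haveI : IsIso (Spec.map (CommRingCat.ofHom (e : R →+* R₁ K)) ∣_ U) := inferInstance
  haveI : Nonempty (((Spec.map (CommRingCat.ofHom (e : R →+* R₁ K))) ⁻¹ᵁ U : (Spec (CommRingCat.of (R₁ K))).Opens) :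
      Scheme.{u}) := by
    obtain ⟨x⟩ := ‹Nonempty (U : Scheme.{u})›
    exact ⟨(inv (Spec.map (CommRingCat.ofHom (e : R →+* R₁ K)) ∣_ U)) x⟩
  haveI : IsDominant ((Spec.map (CommRingCat.ofHom (e : R →+* R₁ K)) ∣_ U) ≫ f) := inferInstance
  refine AbelianVariety.exists_eq_hom_comp_of_isDominant C
    ((Spec.map (CommRingCat.ofHom (e : R →+* R₁ K)) ∣_ U) ≫ f) ?_ A ψ
  rw [Category.assoc, hfw, ← Category.assoc, morphismRestrict_ι, Category.assoc, specMap_ofHom_comp_specMap_ofHom]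
  congr 3
  exact e.toAlgHom.comp_algebraMap

/-- **Every `K`-morphism from a non-empty open of the affine line `𝔸¹_K` to an abelian variety is constant**
(a rational map `𝔸¹ ⇢ A` is constant): `g = (U → Spec K) ≫ P₀`. [cite: Milne1986AbelianVarieties, §3 Thm. 3.1 and Cor. 3.8 (p. 107)] -/
theorem AbelianVariety.exists_eq_comp_of_opens_affineLine (U : (Spec (CommRingCat.of (R₁ K))).Opens)
    [Nonempty (U : Scheme.{u})] (A : AbelianVariety K) (g : (U : Scheme.{u}) ⟶ A.X.left)
    (hg : g ≫ A.X.hom = U.ι ≫ Spec.map (CommRingCat.ofHom (algebraMap K (R₁ K)))) :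
    ∃ P₀ : Spec (.of K) ⟶ A.X.left, P₀ ≫ A.X.hom = 𝟙 _ ∧
      g = (U.ι ≫ Spec.map (CommRingCat.ofHom (algebraMap K (R₁ K)))) ≫ P₀ := by
  haveI : Nonempty U := by
    obtain ⟨x⟩ := ‹Nonempty (U : Scheme.{u})›
    exact ⟨x⟩
  haveI : IsIntegral (Over.mk (U.ι ≫ Spec.map (CommRingCat.ofHom (algebraMap K (R₁ K)))) : SchemeOver K).left :=
    inferInstanceAs (IsIntegral (U : Scheme.{u}))
  obtain ⟨P₀, hP₀, h⟩ := @AbelianVariety.exists_eq_hom_comp_of_isDominant K _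
    (Over.mk (U.ι ≫ Spec.map (CommRingCat.ofHom (algebraMap K (R₁ K)))) : SchemeOver K) _ U _
    (𝟙 (U : Scheme.{u})) ⟨fun x => subset_closure ⟨x, rfl⟩⟩ (by exact Category.id_comp _) A (Over.homMk g hg)
  exact ⟨P₀, hP₀, h⟩

end RationalMaps

section ProjectiveLine

variable {K : Type u} [Field K]

set_option backward.isDefEq.respectTransparency false in
/-- **Milne, *Abelian Varieties*, §3 Cor. 3.8 as printed: every rational map `ℙ¹ ⇢ A` is constant** — every
`K`-morphism `g : U → A` from a non-empty open `U ⊆ ℙ¹_K` to an abelian variety is `g = (U → Spec K) ≫ P₀`. (`U`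
meets the standard chart `D₊(x₀) ≅ 𝔸¹`, which dominates `U`; the morphism form on all of `ℙ¹` is ★
`Milne1986_projectiveLine_to_abelianVariety_const_holds`.) [cite: Milne1986AbelianVarieties, §3 Cor. 3.8 (p. 107)] -/
theorem AbelianVariety.exists_eq_comp_of_opens_projectiveLine (U : (projectiveSpace 1 K).left.Opens)
    [Nonempty (U : Scheme.{u})] (A : AbelianVariety K) (g : (U : Scheme.{u}) ⟶ A.X.left)
    (hg : g ≫ A.X.hom = U.ι ≫ (projectiveSpace 1 K).hom) :
    ∃ P₀ : Spec (.of K) ⟶ A.X.left, P₀ ≫ A.X.hom = 𝟙 _ ∧ g = (U.ι ≫ (projectiveSpace 1 K).hom) ≫ P₀ := by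
  haveI : Nonempty U := by
    obtain ⟨x⟩ := ‹Nonempty (U : Scheme.{u})›
    exact ⟨x⟩
  haveI : IsIntegral (Over.mk (U.ι ≫ (projectiveSpace 1 K).hom) : SchemeOver K).left :=
    inferInstanceAs (IsIntegral (U : Scheme.{u}))
  letI : GradedAlgebra (MvPolynomial.homogeneousSubmodule (Fin (1 + 1)) K) := MvPolynomial.gradedAlgebra
  letI : Algebra K (HomogeneousLocalization.Away (MvPolynomial.homogeneousSubmodule (Fin (1 + 1)) K)
      (MvPolynomial.X 0)) := ProjBaseChange.algebraBase _ _
  -- the chart `j : Spec (K[x₀,x₁]_{x₀})₀ → ℙ¹` contains the generic point, which lies in `U`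
  have hgen := genericPoint_spec ↥(projectiveSpace 1 K).left
  have hηU : genericPoint ↥(projectiveSpace 1 K).left ∈ (U : Set ↥(projectiveSpace 1 K).left) :=
    (hgen.mem_open_set_iff U.isOpen).2 (by
      obtain ⟨x⟩ := ‹Nonempty U›
      exact ⟨x.1, True.intro, x.2⟩)
  obtain ⟨y, hy⟩ := ProjectiveSpace.genericPoint_mem_range_chartCover_f 1 K (0 : Fin (1 + 1))
  obtain ⟨y₀, hy₀⟩ : genericPoint ↥(projectiveSpace 1 K).left ∈ Set.range ((ProjectiveSpace.chartCover 1 K).f (0 : Fin (1 + 1))) :=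
    (hgen.mem_open_set_iff ((ProjectiveSpace.chartCover 1 K).f (0 : Fin (1 + 1))).isOpenEmbedding.isOpen_range).2 ⟨((ProjectiveSpace.chartCover 1 K).f (0 : Fin (1 + 1))) y, True.intro, y, rfl⟩
  haveI : Nonempty (((((ProjectiveSpace.chartCover 1 K).f (0 : Fin (1 + 1))) ⁻¹ᵁ U : ((ProjectiveSpace.chartCover 1 K).X (0 : Fin (1 + 1))).Opens)) : Scheme.{u}) :=
    ⟨⟨y₀, show ((ProjectiveSpace.chartCover 1 K).f (0 : Fin (1 + 1))) y₀ ∈ (U : Set ↥(projectiveSpace 1 K).left) by rw [hy₀]; exact hηU⟩⟩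
  -- its restriction `f = j|_U : j⁻¹ U → U` is dominant (an open immersion with non-empty image in the irreducible `ℙ¹`)
  haveI : IsDominant (((ProjectiveSpace.chartCover 1 K).f (0 : Fin (1 + 1)) ∣_ U) ≫ U.ι) := by
    rw [morphismRestrict_ι]
    exact ⟨(((((ProjectiveSpace.chartCover 1 K).f (0 : Fin (1 + 1))) ⁻¹ᵁ U).ι ≫ (ProjectiveSpace.chartCover 1 K).f (0 : Fin (1 + 1))).isOpenEmbedding.isOpen_range.dense (Set.range_nonempty _))⟩
  haveI : IsDominant ((ProjectiveSpace.chartCover 1 K).f (0 : Fin (1 + 1)) ∣_ U) := IsDominant.of_comp_of_isOpenImmersion _ U.ι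
  have hj : (ProjectiveSpace.chartCover 1 K).f (0 : Fin (1 + 1)) ≫ (projectiveSpace 1 K).hom =
      Spec.map (CommRingCat.ofHom (algebraMap K (HomogeneousLocalization.Away
        (MvPolynomial.homogeneousSubmodule (Fin (1 + 1)) K) (MvPolynomial.X 0)))) :=
    ProjectiveSpace.chartCover_f_comp_projToSpec 1 K (0 : Fin (1 + 1))
  obtain ⟨P₀, hP₀, h⟩ := AbelianVariety.exists_eq_hom_comp_of_isDominant_of_algEquiv
    (Over.mk (U.ι ≫ (projectiveSpace 1 K).hom) : SchemeOver K) (ProjectiveSpace.chartAlgEquiv K (0 : Fin (1 + 1)))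
    (U := ((ProjectiveSpace.chartCover 1 K).f (0 : Fin (1 + 1))) ⁻¹ᵁ U) ((ProjectiveSpace.chartCover 1 K).f (0 : Fin (1 + 1)) ∣_ U)
    (by
      change ((ProjectiveSpace.chartCover 1 K).f (0 : Fin (1 + 1)) ∣_ U) ≫ U.ι ≫ (projectiveSpace 1 K).hom = _
      rw [← Category.assoc, morphismRestrict_ι, Category.assoc, hj])
    A (Over.homMk g hg)
  exact ⟨P₀, hP₀, h⟩

end ProjectiveLine

section ProjectiveLineWhole

variable {K : Type u} [Field K]

set_option backward.isDefEq.respectTransparency false in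
/-- **Every `K`-morphism `ℙ¹_K → A` to an abelian variety FACTORS THROUGH A SECTION**: `f = (ℙ¹ → Spec K) ≫ P₀` — the
scheme-theoretic form of ★ `Milne1986_projectiveLine_to_abelianVariety_const` (which records constancy on points); the
chart `D₊(x₀) ≅ 𝔸¹ → ℙ¹` is a dominant open immersion, so ★ `AbelianVariety.exists_eq_hom_comp_of_isDominant` applies after
transport along `chartAlgEquiv`. [cite: Milne1986AbelianVarieties, §3 Cor. 3.8 (p. 107)] -/
theorem AbelianVariety.exists_eq_hom_comp_projectiveLine (A : AbelianVariety K) (f : projectiveSpace 1 K ⟶ A.X) :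
    ∃ P₀ : Spec (.of K) ⟶ A.X.left, P₀ ≫ A.X.hom = 𝟙 _ ∧ f.left = (projectiveSpace 1 K).hom ≫ P₀ := by
  letI : GradedAlgebra (MvPolynomial.homogeneousSubmodule (Fin (1 + 1)) K) := MvPolynomial.gradedAlgebra
  letI : Algebra K (HomogeneousLocalization.Away (MvPolynomial.homogeneousSubmodule (Fin (1 + 1)) K)
      (MvPolynomial.X 0)) := ProjBaseChange.algebraBase _ _
  have hgen := genericPoint_spec ↥(projectiveSpace 1 K).left
  obtain ⟨y, hy⟩ := ProjectiveSpace.genericPoint_mem_range_chartCover_f 1 K (0 : Fin (1 + 1))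
  haveI : Nonempty ((⊤ : ((ProjectiveSpace.chartCover 1 K).X (0 : Fin (1 + 1))).Opens) : Scheme.{u}) := ⟨⟨y, True.intro⟩⟩
  -- the chart `⊤ ↪ Spec (K[x₀,x₁]_{x₀})₀ → ℙ¹` is a dominant open immersion
  haveI : IsDominant ((⊤ : ((ProjectiveSpace.chartCover 1 K).X (0 : Fin (1 + 1))).Opens).ι ≫
      (ProjectiveSpace.chartCover 1 K).f (0 : Fin (1 + 1))) :=
    ⟨((⊤ : ((ProjectiveSpace.chartCover 1 K).X (0 : Fin (1 + 1))).Opens).ι ≫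
      (ProjectiveSpace.chartCover 1 K).f (0 : Fin (1 + 1))).isOpenEmbedding.isOpen_range.dense (Set.range_nonempty _)⟩
  have hj : (ProjectiveSpace.chartCover 1 K).f (0 : Fin (1 + 1)) ≫ (projectiveSpace 1 K).hom =
      Spec.map (CommRingCat.ofHom (algebraMap K (HomogeneousLocalization.Away
        (MvPolynomial.homogeneousSubmodule (Fin (1 + 1)) K) (MvPolynomial.X 0)))) :=
    ProjectiveSpace.chartCover_f_comp_projToSpec 1 K (0 : Fin (1 + 1))
  exact AbelianVariety.exists_eq_hom_comp_of_isDominant_of_algEquiv (projectiveSpace 1 K)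
    (ProjectiveSpace.chartAlgEquiv K (0 : Fin (1 + 1))) (U := ⊤)
    ((⊤ : ((ProjectiveSpace.chartCover 1 K).X (0 : Fin (1 + 1))).Opens).ι ≫ (ProjectiveSpace.chartCover 1 K).f (0 : Fin (1 + 1)))
    (by rw [Category.assoc, hj]) A f

end ProjectiveLineWhole

end Literature.AlgebraicGeometry.Motives

end
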